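import Literature.NumberTheory.EllipticCurves.Kato2004.IwasawaH1Reduction
import Literature.NumberTheory.EllipticCurves.HeegnerModuleIndex
import HarnessLib

/-!
# Kato 2004 (Astérisque 295) §14.1 / Bloch–Kato: the FINITE (Selmer) classes
# `H¹_f(F, T_pW) ⊂ H¹(F, T_pW)` of the continuous Tate-module cohomology, defined WITHOUT a Kummer map
# as the preimage of the tree's compact Selmer group `S_p(E/F) = lim←_k Sel^{(p^k)}(E/F)` under the
# reductions `H¹(F, T_pW) → H¹(F, W[p^k])`; and the `p`-DIVISIBILITY POSITION of a class relative to a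
# subgroup (the rank-one pin of the cell `bsd-potss`, seat kmc, part 17b)

Topic `NumberTheory/EllipticCurves`, sub-directory `Kato2004` (namespace = path). Seat `bsd-potss-kmc`
(prover, cell `bsd-potss`), generation 10, part 17b; definition request D-O6-2″ (items K9 19200
`WildRankOne` / KT 19984 `TameRankOne`). DEFINITIONS with bodies and PROVED lemmas only; no named fact;
nothing asserted.

## Why (memo v9 §2 of the seat)

The rank-one Kato descent at a member `W_K` needs, besides the multiplier pin
(`Kato2004/MemberMultiplierInputs.lean`), the POSITION of the bottom layer `𝐲₀ = proj₀ 𝐲 ∈ H¹(ℚ, T_pW_K)`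
of the pinned zeta class relative to the Mordell–Weil line: in analytic rank one
`H¹_f(ℚ, T_pW_K) ≅ E(ℚ) ⊗ ℤ_p` (Gross–Zagier–Kolyvagin: `Ш[p^∞]` finite) is a `ℤ_p`-module of rank one
containing `H¹(ℤ[1/p], T_pW_K) ∋ 𝐲₀` (Burns–Kurihara–Sano 2019, (h1) p. 9: `H¹(ℤ_S, V) = H¹_f(ℚ, V)` when
`L(E,1) = 0`), and Perrin-Riou's conjecture up to a `p`-adic unit reads
`v_p(L′(E,1)/(Ω·Reg)) = pos(𝐲₀) − v_p log_ω(x) − v_p λ(0)` with `pos(𝐲₀)` the `p`-divisibility of `𝐲₀`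
in `H¹_f(ℚ,T)/torsion ≅ ℤ_p` and `x` a Mordell–Weil generator (`log_ω(loc_p 𝐲₀) = u·p^{pos}·log_ω(x)`:
the Bloch–Kato logarithm is compatible with the Kummer map and kills torsion).  So what the tree needs
is NOT the Kummer MAP `E(ℚ_p) ⊗ ℤ_p → H¹(ℚ_p, T)` of the g9 spec but only the Selmer SUBGROUP
`H¹_f(ℚ, T_pW) ⊂ H¹(ℚ, T_pW)` — and the tree already has every ingredient: the continuous cohomology
`H1 (tateRep W p) U` (`EulerSystem.lean`), the change of coefficients on cocycles `mapH1AddHom`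
(`IwasawaH1Reduction.lean`, there for `T_pW → W[p]`), and Perrin-Riou's compact Selmer group
`WeierstrassCurve.compactSelmerOver W U p ⊂ ∏_k H¹(U, W[p^k])` (`HeegnerModuleIndex.lean`: Selmer at
every level — local conditions "dies in `H¹(U_{K_v}, E(K̄_v))`" at every place, exactly the tree's
`selmerGroupOver` convention — and compatible under `p_*`).  This file composes them.

## Contents (all PROVED / definitional)

* `tateModPow W p k : T_pW →+ W[p^k]` (`a ↦ a_k`, `TateModule.proj p k`; continuous, `Γ_ℚ`-equivariant)
  and `reduceH1Pow W p k U : H¹(U, T_pW) →+ H¹(U, W[p^k])` — the target `H1 (W.torsionGaloisModule (p^k)) U`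
  IS the tree's `W.torsionH1Over (p^k) U` (definitionally: `toTopRep_torsionGaloisModule` and
  `subgroupRep (discreteTopRep Γ M) U = discreteTopRep U M`, both `rfl`); on cocycles `[φ] ↦ [φ mod p^k]`.
* `reduceTorsionH1_reduceH1Pow`: `p_* ∘ red_{k+1} = red_k` (`p • a_{k+1} = a_k` in `T_pW`).
* `reducePi W p U : H¹(U, T_pW) →+ ∏_k H¹(U, W[p^k])` with values in the `p_*`-compatible families
  (`reducePi_compatible`).
* **`finiteH1 W p U : AddSubgroup (H1 (tateRep W p) U)`** := preimage of `compactSelmerOver W U p` —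
  `H¹_f(F, T_pW)` for `F = ℚ̄^U` (`U` normal): `mem_finiteH1_iff` — a class is finite iff ALL its
  reductions are Selmer classes.  READING: under `H¹(F, T_pW) = lim←_k H¹(F, W[p^k])` (Tate; Rubin,
  *Euler Systems*, App. B Prop. B.2.3 — `H⁰(F, W[p^k])` finite) this is `lim←_k Sel^{(p^k)}(E/F) =
  S_p(E/F)`, i.e. Bloch–Kato's `H¹_f(F, T_pE)` (Bloch–Kato 1990 Ex. 3.11 / Kato §14.1: the local condition
  at `p` is the image of `E(F_v) ⊗ ℤ_p`, at `v ∤ p` all of `H¹(F_v, T)` (finite) — and the Kummer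
  condition "dies in `H¹(F_v, E)`" at level `p^k` is exactly that image by the Kummer sequence).  No new
  fact is introduced for this identification; consumers that need it say so.
* **`divPosition p B y : ℕ`** for an additive group `M`, a subgroup `B` and `y : M`: the supremum of the
  `k` with `y ≡ p^k • b (mod torsion of B)` for some `b ∈ B` (junk `0` if unbounded, `Nat.sSup`) — for
  `B/B_tors ≅ ℤ_p` and `y ∈ B` non-torsion this is `ord_p [B/B_tors : ℤ_p ȳ]` (definitions only).

## References

* K. Kato, Astérisque 295 (2004) §14.1 (pp. 234–235: `H¹_f`, `Sel(T) = H¹_f(ℤ[1/p],T)` notation),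
  §8.2/Lemma 8.5. [Kato2004Asterisque]
* S. Bloch, K. Kato, *L-functions and Tamagawa numbers of motives* (1990), §3, Ex. 3.11. [BlochKato1990]
* B. Perrin-Riou, Bull. SMF 115 (1987) §0 p. 401 (`S_p(L) = lim← S(L)^{(p^n)}`). [PerrinRiou1987BSMF]
* K. Rubin, *Euler Systems* (2000), App. B §2 (Prop. B.2.3). [Rubin2000]
* D. Burns, M. Kurihara, T. Sano, arXiv:1910.07404, Hyp. 2.2 and (h1) (p. 9). [BurnsKuriharaSano2019]
* Tree: `Kato2004/IwasawaH1Reduction.lean` (`tateModP`, `reduceH1`, `mapH1AddHom`), `HeegnerModuleIndex.lean`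
  (`torsionH1Over`, `reduceTorsionH1`, `selmerTorsionOver`, `compactSelmerOver`), `TateModule.lean`
  (`TateModule.proj`, `smul_proj_succ`), `GeomPointsGaloisModule.lean` (`torsionGaloisModule`).
-/

noncomputable section

open scoped NumberField
open Field IsDedekindDomain CategoryTheory
open Literature.NumberTheory.GaloisRepresentations
open Literature.NumberTheory.EllipticCurves Literature.NumberTheory.EllipticCurves.Kato2004
open Literature.NumberTheory.EllipticCurves.Kato2004.EulerSystemValues
open WeierstrassCurve (geomPoints geomTorsion)

namespace Literature.NumberTheory.EllipticCurves.Kato2004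

/-! ## §1 Reduction modulo `p^k` on the Tate module and on `H¹` -/

section Reduction

variable (W : WeierstrassCurve ℚ) [W.IsElliptic] (p : ℕ) [Fact p.Prime]

/-- **Reduction modulo `p^k` on the Tate module**: `T_pW → W[p^k]`, `a = (a_n)_n ↦ a_k` (the component
`TateModule.proj p k`, with values in `E(ℚ̄)[p^k] = geomTorsion W (p^k)`); `k = 1` is `tateModP`.
[cite: Kato2004Asterisque, §8.2 (p. 181: `H^q(R,T) = lim← H^q(R, T/p^n)`)] -/
def tateModPow (k : ℕ) : W.tateModule p →+ geomTorsion W ((p : ℤ) ^ k) where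
  toFun a := ⟨TateModule.proj p k a, by
    have h := W.proj_tateModule_mem_geomTorsion p k a
    simpa using h⟩
  map_zero' := Subtype.ext (map_zero _)
  map_add' a b := Subtype.ext (map_add _ a b)

omit [W.IsElliptic] [Fact p.Prime] in
/-- Unfolding `tateModPow`: its value is the `k`-th component. [cite: Kato2004Asterisque, §8.2 (p. 181)] -/
@[simp]
theorem coe_tateModPow_apply (k : ℕ) (a : W.tateModule p) :
    ((tateModPow W p k a : geomTorsion W ((p : ℤ) ^ k)) : geomPoints W) = TateModule.proj p k a :=
  rfl

omit [W.IsElliptic] [Fact p.Prime] in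
/-- `tateModPow` is continuous (components of `T_pW` are continuous, `W[p^k]` is discrete).
[cite: Kato2004Asterisque, §8.2 (p. 181)] -/
theorem continuous_tateModPow (k : ℕ) : Continuous (tateModPow W p k) :=
  Continuous.subtype_mk (TateModule.continuous_proj (A := geomPoints W) (p := p) k) _

omit [W.IsElliptic] [Fact p.Prime] in
/-- `tateModPow` is `Γ_ℚ`-equivariant (the action on `T_pW` is componentwise).
[cite: Kato2004Asterisque, §8.2 (p. 181)] -/
theorem tateModPow_smul (k : ℕ) (σ : absoluteGaloisGroup ℚ) (a : W.tateModule p) :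
    tateModPow W p k (σ • a) = σ • tateModPow W p k a :=
  Subtype.ext (by
    rw [coe_tateModPow_apply, TateModule.proj_smul_of_distribMulAction,
      AddSubgroup.torsionBy.coe_smul, coe_tateModPow_apply])

omit [W.IsElliptic] [Fact p.Prime] in
/-- `p • a_{k+1} = a_k`: the components of an element of `T_pW` are compatible under multiplication by
`p` (`TateModule.smul_proj_succ`), stated through the tree's `geomTorsionReduce`.
[cite: PerrinRiou1987BSMF, §0 p. 401] -/
theorem geomTorsionReduce_tateModPow_succ (k : ℕ) (a : W.tateModule p) :
    W.geomTorsionReduce p k (tateModPow W p (k + 1) a) = tateModPow W p k a := by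
  refine Subtype.ext ?_
  rw [WeierstrassCurve.coe_geomTorsionReduce, coe_tateModPow_apply, coe_tateModPow_apply,
    natCast_zsmul, TateModule.smul_proj_succ]

variable [ContinuousSMul ℤ_[p] (W.tateModule p)]

/-- Equivariance of `tateModPow` for the restricted representations `T_pW|_U`, `W[p^k]|_U`
(the hypothesis shape of `mapH1AddHom`). [cite: Kato2004Asterisque, §8.2 (p. 181)] -/
theorem tateModPow_subgroupRep (k : ℕ) (U : Subgroup (absoluteGaloisGroup ℚ)) (u : U)
    (a : W.tateModule p) :
    tateModPow W p k ((subgroupRep (tateRep W p).toTopRep U).ρ u a) =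
      (subgroupRep (W.torsionGaloisModule ((p : ℤ) ^ k)).toTopRep U).ρ u (tateModPow W p k a) :=
  tateModPow_smul W p k (u : absoluteGaloisGroup ℚ) a

/-- **The reduction `red_k : H¹(U, T_pW) → H¹(U, W[p^k])`** for a subgroup `U ≤ Γ_ℚ` (`U = Gal(ℚ̄/F)`),
induced on continuous cochains by `a ↦ a_k` (`mapH1AddHom` along `tateModPow`).  Its target
`H1 (W.torsionGaloisModule (p^k)) U` is DEFINITIONALLY the tree's `W.torsionH1Over (p^k) U = H¹(U, E[p^k])`
of `HeegnerModuleIndex.lean` (the home of the compact Selmer group), so it is typed with that target.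
[cite: Kato2004Asterisque, §8.2 (p. 181), §13.8 (p. 228)] -/
def reduceH1Pow (k : ℕ) (U : Subgroup (absoluteGaloisGroup ℚ)) :
    H1 (tateRep W p) U →+ W.torsionH1Over ((p : ℤ) ^ k) U :=
  mapH1AddHom (subgroupRep (tateRep W p).toTopRep U)
    (subgroupRep (W.torsionGaloisModule ((p : ℤ) ^ k)).toTopRep U) (tateModPow W p k)
    (continuous_tateModPow W p k) (tateModPow_subgroupRep W p k U)

/-- `reduceH1Pow` on explicit cocycles: `red_k [φ] = [φ mod p^k]`. [cite: Kato2004Asterisque, §8.2 (p. 181)] -/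
theorem reduceH1Pow_oneCocycleClass (k : ℕ) (U : Subgroup (absoluteGaloisGroup ℚ))
    (φ : contOneCocycles (subgroupRep (tateRep W p).toTopRep U)) :
    reduceH1Pow W p k U (oneCocycleClass _ φ) =
      oneCocycleClass (subgroupRep (W.torsionGaloisModule ((p : ℤ) ^ k)).toTopRep U)
        (contOneCocycles.pushAddHom (tateModPow W p k) (continuous_tateModPow W p k)
          (tateModPow_subgroupRep W p k U) φ) :=
  mapH1AddHom_oneCocycleClass _ _ _ φ

/-- **`p_* ∘ red_{k+1} = red_k`**: the reductions of a class of `H¹(U, T_pW)` form a family compatible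
under the transition maps `p_* : H¹(U, E[p^{k+1}]) → H¹(U, E[p^k])` of the compact Selmer group
(`reduceTorsionH1`).  Proved on cocycles (`p • a_{k+1} = a_k`).
[cite: PerrinRiou1987BSMF, §0 p. 401] [cite: Kato2004Asterisque, §8.2 (p. 181)] -/
theorem reduceTorsionH1_reduceH1Pow (k : ℕ) (U : Subgroup (absoluteGaloisGroup ℚ))
    (c : H1 (tateRep W p) U) :
    W.reduceTorsionH1 p k U (reduceH1Pow W p (k + 1) U c) = reduceH1Pow W p k U c := by
  obtain ⟨φ, rfl⟩ := oneCocycleClass_surjective _ c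
  rw [reduceH1Pow_oneCocycleClass, reduceH1Pow_oneCocycleClass, WeierstrassCurve.reduceTorsionH1,
    resH1Hom]
  change ContinuousCohomology.map _ _ 1 (oneCocycleClass (discreteTopRep U (geomTorsion W _)) _) = _
  rw [map_oneCocycleClass]
  congr 1
  refine Subtype.ext (ContinuousMap.ext fun u ↦ ?_)
  rw [contOneCocycles.pullback_apply]
  change W.geomTorsionReduce p k (tateModPow W p (k + 1) (φ.1 u)) = tateModPow W p k (φ.1 u)
  exact geomTorsionReduce_tateModPow_succ W p k (φ.1 u)

/-- The family of all reductions: `H¹(U, T_pW) → ∏_k H¹(U, E[p^k])`, `c ↦ (red_k c)_k`.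
[cite: Kato2004Asterisque, §8.2 (p. 181)] [cite: PerrinRiou1987BSMF, §0 p. 401] -/
def reducePi (U : Subgroup (absoluteGaloisGroup ℚ)) :
    H1 (tateRep W p) U →+ (Π k : ℕ, W.torsionH1Over ((p : ℤ) ^ k) U) :=
  AddMonoidHom.pi fun k ↦ reduceH1Pow W p k U

/-- Components of `reducePi`. [cite: Kato2004Asterisque, §8.2 (p. 181)] -/
@[simp]
theorem reducePi_apply (U : Subgroup (absoluteGaloisGroup ℚ)) (c : H1 (tateRep W p) U) (k : ℕ) :
    reducePi W p U c k = reduceH1Pow W p k U c :=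
  rfl

/-- The family of reductions of a class is `p_*`-compatible. [cite: PerrinRiou1987BSMF, §0 p. 401] -/
theorem reducePi_compatible (U : Subgroup (absoluteGaloisGroup ℚ)) (c : H1 (tateRep W p) U) (k : ℕ) :
    W.reduceTorsionH1 p k U (reducePi W p U c (k + 1)) = reducePi W p U c k := by
  rw [reducePi_apply, reducePi_apply, reduceTorsionH1_reduceH1Pow]

end Reduction

/-! ## §2 The finite (Selmer) classes `H¹_f(F, T_pW) ⊂ H¹(F, T_pW)` -/

section Finite

variable (W : WeierstrassCurve ℚ) [W.IsElliptic] (p : ℕ) [Fact p.Prime]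
  [ContinuousSMul ℤ_[p] (W.tateModule p)]
  (U : Subgroup (absoluteGaloisGroup ℚ)) [U.Normal]

/-- **`H¹_f(F, T_pW)`**, the FINITE (Bloch–Kato / Selmer) classes of `H¹(F, T_pW)` for `F = ℚ̄^U`
(`U ≤ Γ_ℚ` normal): the classes whose reductions `(red_k c)_k` form an element of Perrin-Riou's compact
Selmer group `S_p(E/F) = lim←_k Sel^{(p^k)}(E/F)` (the tree's `compactSelmerOver`, Selmer conditions at
every place of `F` in the convention of `selmerGroupOver`).  Definition by preimage — no Kummer map; see
the module docstring for the READING `= lim←_k Sel^{(p^k)}(E/F) = H¹_f(F, T_pE)` (Kato §14.1, Bloch–Kato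
Ex. 3.11).  For `F = ℚ` in analytic rank one this is `E(ℚ) ⊗ ℤ_p` up to the (finite, here trivial)
Tate module of `Ш` — not used here.
[cite: Kato2004Asterisque, §14.1 (pp. 234–235)] [cite: BlochKato1990, Ex. 3.11] [cite: PerrinRiou1987BSMF, §0 p. 401] -/
def finiteH1 : AddSubgroup (H1 (tateRep W p) U) :=
  (W.compactSelmerOver U p).comap (reducePi W p U)

/-- Membership in `H¹_f(F, T_pW)`: EVERY reduction `red_k c ∈ Sel^{(p^k)}(E/F)` (the `p_*`-compatibility
half of `compactSelmerOver` is automatic for reductions of one class, `reducePi_compatible`).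
[cite: Kato2004Asterisque, §14.1 (pp. 234–235)] [cite: PerrinRiou1987BSMF, §0 p. 401] -/
theorem mem_finiteH1_iff (c : H1 (tateRep W p) U) :
    c ∈ finiteH1 W p U ↔ ∀ k : ℕ, reduceH1Pow W p k U c ∈ W.selmerTorsionOver U ((p : ℤ) ^ k) := by
  rw [finiteH1, AddSubgroup.mem_comap, WeierstrassCurve.mem_compactSelmerOver_iff]
  constructor
  · rintro ⟨h, -⟩ k
    simpa using h k
  · intro h
    exact ⟨fun k ↦ by simpa using h k, fun k ↦ reducePi_compatible W p U c k⟩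

end Finite

/-! ## §3 The `p`-divisibility position of a class relative to a subgroup -/

section Position

variable {M : Type*} [AddCommGroup M] (p : ℕ) (B : AddSubgroup M) (y : M)

/-- The set of exponents `k` such that `y ≡ p^k • b` modulo a TORSION element of `B`, for some `b ∈ B`.
[cite: BurnsKuriharaSano2019, Hyp. 2.2 and (h1) (p. 9)] -/
def divPositionSet : Set ℕ :=
  {k : ℕ | ∃ b ∈ B, ∃ t ∈ B, IsOfFinAddOrder t ∧ y = (p ^ k : ℕ) • b + t}

/-- **The `p`-divisibility position** `pos_B(y)` of `y` relative to the subgroup `B`: the supremum of the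
exponents `k` with `y ≡ p^k • b (mod B_tors)` for some `b ∈ B` (`Nat.sSup`; junk `0` when the set is
unbounded — e.g. `y` torsion — or empty — `y ∉ B`).  For `B/B_tors ≅ ℤ_p` and `y ∈ B` non-torsion it is
`ord_p [B/B_tors : ℤ_p·ȳ]`; intended use: `B = H¹_f(ℚ, T_pW_K)` (rank one in analytic rank one) and
`y = 𝐲₀` the bottom layer of the pinned zeta class, so that `log_ω(loc_p 𝐲₀) = u·p^{pos}·log_ω(x)` for a
Mordell–Weil generator `x`, `u ∈ ℤ_p^×` (memo v9 §2 of seat kmc).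
[cite: BurnsKuriharaSano2019, Hyp. 2.2 and (h1) (p. 9), Thm. 1.4 (p. 4)] -/
def divPosition : ℕ :=
  sSup (divPositionSet p B y)

end Position

end Literature.NumberTheory.EllipticCurves.Kato2004

end
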